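import Summits.QuantumFields.YangMills.Theses.HyperbolicRegulator
import Literature.MathematicalPhysics.QuantumLattice.LatticeGaugeDLRGibbsProofs
import Summits.QuantumFields.YangMills.Theorems.ContractibleFibreFibreToTorusStubTorusLimitTranslationInvariant
import Summits.QuantumFields.YangMills.Theorems.HyperbolicRegulatorHyperbolicToTorusRDefs
import Summits.QuantumFields.YangMills.Theorems.HyperbolicRegulatorHyperbolicToTorusRStubReplicaDecoupling
import Summits.QuantumFields.YangMills.Theorems.HyperbolicToTorusR.Negative.ExtremalInvariantStatesStrength

/-!
# Line `replica-rooting` for crux `HyperbolicToTorusR` (stmt-QuantumFields-18156) — `Lines/replica_rooting.lean`, reshape r2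

Lead `prover-line-stmt-QuantumFields-18156-0` (2026-08-17), on the strategist's PRIMARY line
(`planner-cstrat-stmt-QuantumFields-18156-b1-0`; original cut H₂ → PTU → EXT → RT → V, skeleton sha `79b7961b…`).
Namespace `Summit.QuantumFields.YangMills.Cruxes.HyperbolicToTorusR.ReplicaRooting`; the vocabulary (`Fam`, `Sp`,
`IsRootedPairState`, `shiftObs`, `prodObs`, `IsPairApprox`) now lives in the LANDED Defs file
`Theorems/HyperbolicRegulatorHyperbolicToTorusRDefs.lean` (p172526, p173659) in this namespace.

## Reshape log

* r1 (sha `c79b3092`): dropped the redundant `(d := 4)` named arguments from the EXT/RT/V stub headers (the stub registry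
  truncates signatures at the first `:=`).
* r2 (this file): (i) stub (RT) `stub_replicaDecoupling` LANDED — `Theorems/HyperbolicRegulatorHyperbolicToTorusRStubReplicaDecoupling.lean`
  (p173300; helper `…PairProduct.lean` p173076: conditional DLR + extremal marginal ⇒ `Q = Q₁ ⊗ Q₁`, disintegration-free);
  (ii) stub (PTU) `stub_pressureTangentUnique` DROPPED as redundant — the disprover's landed
  `Theorems/HyperbolicToTorusR/Negative/ExtremalInvariantStatesStrength.lean` shows EXT(β) ⇒ at most one translation-invariant
  DLR state ⇒ U_tr(β) (`speciesIntegral_eq_of_extremal`), so the tangent bridge is not needed (Disproof.lean §3,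
  `hyperbolicToTorusR_of_four_stubs`); (iii) stub (H₂) `stub_rootedPairLimit` SPLIT at the skeleton level into
  H₂a `stub_rootedPairApprox` (finite-`k`: the root-averaged law of two independent chart-read samples of the family is an
  `IsPairApprox` sequence — all the hyperbolic / chart work) and H₂b `stub_pairLimit` (abstract: an `IsPairApprox` sequence has
  a weak limit point which is a rooted pair state obeying the table — the pair version of the sibling's landed
  `FibreToTorus.tubeLimit_dlrLimit`), glued by `rootedPairLimit_of` below (sorry-free).

## The cut now: (H₂a, H₂b) → EXT → [RT landed] → V

* `stub_rootedPairApprox` (H₂a, buildable, size L — lead) · family admissible ∀ k ≥ 8, table at (β, m) ⇒ ∀ A B ∃ C ∃ P,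
  `IsPairApprox r β m C A B P`.  Mechanism: deep base pair (A8), product chart of sup-radius ⌊k/4⌋ (A9), roots in the box of
  radius ⌊k/16⌋, `P_k := avg_w (S_w)_*μ_k ⊗ (S_w)_*μ_k`; DLR inside charts by the sibling's `tubeLimit_localDLR` (signed-chart
  variant) + the chart split of the `Fam` action (three square sorts ↔ six plaquette orientations, `Re tr` cyclic/inversion
  invariant); asymptotic invariance from `(S_w)_*μ ∘ τ_v⁻¹ = (S_{w−v})_*μ` and the Følner boundary `|W Δ (W−v)|/|W| → 0`;
  table from the crux hypothesis read at base points `cV x w₁`, `cV x (w₁ + n e₀)` through the ≤ 64 frame images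
  (chart rigidity, landed `Theorems/HyperbolicToTorus/Negative/ChartRigidity*`), `C := max`, graph distance = ℓ¹ below the
  chart scale.
* `stub_pairLimit` (H₂b, buildable, size M — worker) · `IsPairApprox r β m C A B P` ⇒ ∃ Q, `IsRootedPairState r β Q` ∧ table.
  Mechanism: compactness of `ProbabilityMeasure (Ω × Ω)` (as `kink_exists_subseq_weakLimit`), swap / marginal invariance pass to
  weak limits (test on bounded continuous functions, `ext_of_forall_lintegral_eq_of_IsFiniteMeasure`), conditional DLR passes
  via the Feller property of the doubly-smoothed joint cylinder functions and the truncation device `exists_piecewise_tendsto`,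
  then `Q.bind K_Λ = Q` for the kernel `K_Λ p = δ_{p.1} ⊗ γ_Λ(p.2)`; the table passes by `le_of_tendsto` after double smoothing.
* `stub_extremalInvariantStates` (EXT, OPEN) · verdict wave 1: `stub-blocked: CertificationLength.CompleteAnalyticityAtLargeScales`
  (stmt-QuantumFields-16178); kernel-checked chain EXT ⇐ 𝒢(β) subsingleton ⇐ U ⇐ CA landed as
  `Theorems/HyperbolicRegulatorHyperbolicToTorusRExtremalOfUniqueness.lean` (p173535).
* `stub_torusFiniteSize` (V, OPEN, shared verbatim with the sibling `FibreToTorus`) · sibling verdict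
  `stub-blocked: OneCertifiedCube.FiniteSizeCriterion`.
* `HyperbolicToTorusR_of : H₂a → H₂b → EXT → V → HyperbolicToTorusR` — PROVED below without `sorry` (RT by the landed stub, U_tr
  from EXT by the landed Negative lemma, periodic limit points DLR + translation invariant by landed theorems; conclusion = the
  route decl BY NAME).

## Disproof used / negatives

`Cruxes/HyperbolicToTorusR/Disproof.lean` (cdisprove cycle 1, 2026-08-17T18:22Z): F0-R/F2-R (no `_false_without_` lemma; A8 is
the only clause excluding the empty complex — H₂a USES A8 for the deep base pair and A9 for the charts); §3 L1 (EXT ⊇ U_tr, PTU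
redundant) — ADOPTED in r2; §4 L2 (chart orientations only up to the point group; 64 frame reads, `C = max`) — this is exactly
H₂a's table transport.  No `-- Targets` entry against H₂a/H₂b at the time of writing.  Typing checklist: bounded measurable
integrands under probability measures only; `IsExtremalGibbs` over `gibbsMeasures` (probability measures); the conditional-DLR
clauses are identities of integrals of bounded functions / of `ℝ≥0∞`-valued measures of measurable sets.
-/

noncomputable section

namespace Summit.QuantumFields.YangMills.Cruxes.HyperbolicToTorusR.ReplicaRooting

open scoped BigOperators Topology Manifold Classical MeasureTheory ProbabilityTheory Matrix InnerProductSpace ComplexConjugate ContinuousMap ENNReal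
open Filter Set Function TopologicalSpace MeasureTheory
open Literature.MathematicalPhysics.QuantumFieldTheory (LatticeRep YMSpecies IsCompactSimpleLieGroup latticeConnectedCorr
  haarProbability zdHaar)
open Literature.Probability.LatticeModels (Site halfOpenBox IsExtremalGibbs)
open Literature.MathematicalPhysics.QuantumLattice (LGConfig ZdEdge configShift configShift_apply gaugeTransformZd
  IsZdGaugeInvariant IsZdTranslationInvariant IsCylinder LocalGaugeObservable ymSpecification ymGibbsMeasures plaquetteObs
  infiniteVolumeLimitPoints mem_ymGibbsMeasures_of_mem_infiniteVolumeLimitPoints_holds)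

/-! `IsPairApprox` — the temporary local copy that stood here (byte-identical with the Defs-file append p173659) was
deleted 2026-08-19 (ops-buildfix): the append has LANDED in `Theorems/HyperbolicRegulatorHyperbolicToTorusRDefs.lean`
(imported above, same namespace), so the local copy no longer elaborates (`IsPairApprox has already been declared`). -/

/-! ## The stub STATEMENTS (named `Prop`s; the registered stubs below repeat them verbatim) -/

/-- **(H₂a) Rooted pair approximation — statement (buildable now; the hyperbolic / chart work).**  For every compact simple
`G`, faithful unitary `r`, every hyperbolic family admissible at all scales `k ≥ 8`, coupling `β`, rate `m > 0` and the crux's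
`k`-UNIFORM clustering table at `(β, m)`: for every pair of species `(A, B)` there are a constant `C` and a sequence of laws
`P k` on `Ω × Ω` with `IsPairApprox r β m C A B P` (the root-averaged law of two independent chart-read samples). -/
def RootedPairApprox : Prop :=
  ∀ (G : Type) [Group G] [TopologicalSpace G] [IsTopologicalGroup G] [CompactSpace G]
    [MeasurableSpace G] [BorelSpace G], IsCompactSimpleLieGroup G →
  ∀ (r : LatticeRep G) (V E Q : ℕ → ℕ → Finset ℕ) (σ τ : ℕ → ℕ → ℕ → ℕ)
  (bd : ℕ → ℕ → ℕ → Fin 4 → ℕ × Bool) (cV : ℕ → ℕ → ℕ → ℤ × ℤ → ℕ)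
  (cE : ℕ → ℕ → ℕ → ℤ × ℤ → Fin 2 → ℕ × Bool),
  (∀ k j, 8 ≤ k → (Fam G r k j (V k j) (E k j) (Q k j) (σ k j) (τ k j) (bd k j) (cV k j) (cE k j)).1) →
  ∀ (β m : ℝ), 0 < m →
  (∀ A B : YMSpecies G, ∃ C : ℝ, ∃ K : ℕ, ∀ k, K ≤ k → Sp A (k / 8) → Sp B (k / 8) →
    ∃ j₀ : ℕ, ∀ j, j₀ ≤ j → (Fam G r k j (V k j) (E k j) (Q k j) (σ k j) (τ k j) (bd k j) (cV k j) (cE k j)).2 β m C A B) →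
  ∀ A B : YMSpecies G, ∃ C : ℝ, ∃ P : ℕ → Measure (LGConfig 4 G × LGConfig 4 G), IsPairApprox r β m C A B P

/-- **(H₂b) Pair limit — statement (buildable now; abstract measure theory on `Ω × Ω`).**  An `IsPairApprox` sequence has a weak
limit point `Q` which is a rooted pair state at `β` obeying the cross-replica table with the same constant (pair version of
Georgii's Thm. 4.17 / the sibling's `tubeLimit_dlrLimit`). -/
def PairLimit : Prop :=
  ∀ (G : Type) [Group G] [TopologicalSpace G] [IsTopologicalGroup G] [CompactSpace G]
    [MeasurableSpace G] [BorelSpace G], IsCompactSimpleLieGroup G →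
  ∀ (r : LatticeRep G) (β m C : ℝ) (A B : YMSpecies G) (P : ℕ → Measure (LGConfig 4 G × LGConfig 4 G)),
  IsPairApprox r β m C A B P →
  ∃ Q : Measure (LGConfig 4 G × LGConfig 4 G), IsRootedPairState r β Q ∧ ∀ n : ℕ,
    |(∫ p, A.F p.1 * B.F (configShift (-Pi.single 0 (n : ℤ)) p.1) ∂Q) -
        ∫ p, A.F p.1 * B.F (configShift (-Pi.single 0 (n : ℤ)) p.2) ∂Q| ≤ C * Real.exp (-(m * n))

/-- **(H₂) Rooted pair limit — statement (now DERIVED: `rootedPairLimit_of` from H₂a and H₂b).**  For every compact simple `G` (any Borel σ-algebra — the crux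
instantiates `borel G`), faithful unitary `r`, every hyperbolic family admissible at all scales `k ≥ 8`, coupling `β`, rate `m > 0` and the
crux's `k`-UNIFORM clustering table at `(β, m)` (VERBATIM the body of `HyperbolicToTorusR`'s hypothesis at `β`): for every
pair of species `(A, B)` there are a rooted pair state `Q` at `β` and a constant `C` with
`|∫ A(ω₁)·τₙB(ω₁) dQ − ∫ A(ω₁)·τₙB(ω₂) dQ| ≤ C e^{−mn}` for all `n` (`τₙ = configShift (−n e₀)`). -/
def RootedPairLimit : Prop :=
  ∀ (G : Type) [Group G] [TopologicalSpace G] [IsTopologicalGroup G] [CompactSpace G]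
    [MeasurableSpace G] [BorelSpace G], IsCompactSimpleLieGroup G →
  ∀ (r : LatticeRep G) (V E Q : ℕ → ℕ → Finset ℕ) (σ τ : ℕ → ℕ → ℕ → ℕ)
  (bd : ℕ → ℕ → ℕ → Fin 4 → ℕ × Bool) (cV : ℕ → ℕ → ℕ → ℤ × ℤ → ℕ)
  (cE : ℕ → ℕ → ℕ → ℤ × ℤ → Fin 2 → ℕ × Bool),
  (∀ k j, 8 ≤ k → (Fam G r k j (V k j) (E k j) (Q k j) (σ k j) (τ k j) (bd k j) (cV k j) (cE k j)).1) →
  ∀ (β m : ℝ), 0 < m →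
  (∀ A B : YMSpecies G, ∃ C : ℝ, ∃ K : ℕ, ∀ k, K ≤ k → Sp A (k / 8) → Sp B (k / 8) →
    ∃ j₀ : ℕ, ∀ j, j₀ ≤ j → (Fam G r k j (V k j) (E k j) (Q k j) (σ k j) (τ k j) (bd k j) (cV k j) (cE k j)).2 β m C A B) →
  ∀ A B : YMSpecies G, ∃ Q : Measure (LGConfig 4 G × LGConfig 4 G), IsRootedPairState r β Q ∧ ∃ C : ℝ, ∀ n : ℕ,
    |(∫ p, A.F p.1 * B.F (configShift (-Pi.single 0 (n : ℤ)) p.1) ∂Q) -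
        ∫ p, A.F p.1 * B.F (configShift (-Pi.single 0 (n : ℤ)) p.2) ∂Q| ≤ C * Real.exp (-(m * n))

/-- **(EXT) Translation-invariant DLR states are pure phases at weak coupling — statement (OPEN, NEW).**  For every compact
simple `G` and faithful unitary `r` there is `β_e` such that at every `β ≥ β_e` every `ℤ⁴`-translation-invariant DLR state of
Wilson's specification `ymSpecification r.ρ β` is an extremal Gibbs state (an extreme point of `𝒢(β)`, tree `IsExtremalGibbs`;
equivalently tail-trivial, Georgii Thm. 7.7 / Friedli–Velenik Thm. 6.58).  Rate-free; excludes exactly the "staggered /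
impure invariant phase" scenario; implied by full DLR uniqueness; non-vacuous (translation-invariant DLR states exist). -/
def ExtremalInvariantStates : Prop :=
  ∀ (G : Type) [Group G] [TopologicalSpace G] [IsTopologicalGroup G] [CompactSpace G]
    [MeasurableSpace G] [BorelSpace G], IsCompactSimpleLieGroup G → ∀ r : LatticeRep G,
    ∃ βe : ℝ, ∀ β : ℝ, βe ≤ β → ∀ μ : MeasureTheory.Measure (LGConfig 4 G),
      μ ∈ ymGibbsMeasures r.ρ β → IsZdTranslationInvariant μ →
        IsExtremalGibbs (ymSpecification r.ρ β) μ

/-- **(RT) Replica decoupling — statement (buildable now).**  For every compact simple `G`, faithful unitary `r`, coupling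
`β`, rate `m`, species `A, B` and constant `C`: IF translation-invariant DLR states at `β` agree on every species (U_tr at
`β`) AND every translation-invariant DLR state at `β` is extremal (EXT at `β`) AND some rooted pair state `Q` at `β` has the
cross-moment table bound `C e^{−mn}` for `(A, B)`, THEN every translation-invariant DLR state `ν` at `β` satisfies
`|cov_ν(A, τₙB)| ≤ C e^{−mn}` for all `n`.  Soft (disintegration + extremality ⇒ `Q = ν ⊗ ν` on species). -/
def ReplicaDecoupling : Prop :=
  ∀ (G : Type) [Group G] [TopologicalSpace G] [IsTopologicalGroup G] [CompactSpace G]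
    [MeasurableSpace G] [BorelSpace G], IsCompactSimpleLieGroup G → ∀ (r : LatticeRep G) (β m : ℝ)
    (A B : YMSpecies G) (C : ℝ),
    (∀ μ ν : MeasureTheory.Measure (LGConfig 4 G), μ ∈ ymGibbsMeasures r.ρ β →
      ν ∈ ymGibbsMeasures r.ρ β → IsZdTranslationInvariant μ → IsZdTranslationInvariant ν →
        ∀ X : YMSpecies G, ∫ U, X.F U ∂μ = ∫ U, X.F U ∂ν) →
    (∀ μ : MeasureTheory.Measure (LGConfig 4 G), μ ∈ ymGibbsMeasures r.ρ β →
      IsZdTranslationInvariant μ → IsExtremalGibbs (ymSpecification r.ρ β) μ) →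
    (∃ Q : Measure (LGConfig 4 G × LGConfig 4 G), IsRootedPairState r β Q ∧ ∀ n : ℕ,
      |(∫ p, A.F p.1 * B.F (configShift (-Pi.single 0 (n : ℤ)) p.1) ∂Q) -
          ∫ p, A.F p.1 * B.F (configShift (-Pi.single 0 (n : ℤ)) p.2) ∂Q| ≤ C * Real.exp (-(m * n))) →
    ∀ ν : MeasureTheory.Measure (LGConfig 4 G), ν ∈ ymGibbsMeasures r.ρ β → IsZdTranslationInvariant ν →
      ∀ n : ℕ, |(∫ U, A.F U * B.F (configShift (-Pi.single 0 (n : ℤ)) U) ∂ν) -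
          (∫ U, A.F U ∂ν) * (∫ U, B.F (configShift (-Pi.single 0 (n : ℤ)) U) ∂ν)| ≤ C * Real.exp (-(m * n))

/-- **(V) Finite-size passage — statement (OPEN; VERBATIM the sibling's `TorusFiniteSize`, one proof closes all).** -/
def TorusFiniteSize : Prop :=
  ∀ (G : Type) [Group G] [TopologicalSpace G] [IsTopologicalGroup G] [CompactSpace G]
    [MeasurableSpace G] [BorelSpace G], IsCompactSimpleLieGroup G → ∀ (r : LatticeRep G) (β₃ : ℝ),
    (∀ β : ℝ, β₃ ≤ β → ∃ m : ℝ, 0 < m ∧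
      ∀ A B : YMSpecies G, ∃ C : ℝ, ∀ μ : MeasureTheory.Measure (LGConfig 4 G),
        μ ∈ infiniteVolumeLimitPoints r.ρ β → ∀ n : ℕ,
          |(∫ U, A.F U * B.F (configShift (-Pi.single 0 (n : ℤ)) U) ∂μ) -
              (∫ U, A.F U ∂μ) * (∫ U, B.F (configShift (-Pi.single 0 (n : ℤ)) U) ∂μ)| ≤
            C * Real.exp (-(m * n))) →
    ∃ β₀ : ℝ, ∀ β : ℝ, β₀ ≤ β → ∃ m : ℝ, 0 < m ∧ ∃ S₁ : ℕ, ∀ A B : YMSpecies G, ∃ C : ℝ,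
      ∀ S n : ℕ, S₁ ≤ S → n ≤ S →
        |latticeConnectedCorr r.ρ β (2 * S + 1) A.F B.F n| ≤ C * Real.exp (-(m * n))

/-! ## The four REGISTERED STUBS (the ONLY `sorry`s of this file; signatures = the statements above, verbatim) -/

/-- Registered stub `stub_rootedPairApprox` (H₂a) : the statement `RootedPairApprox` written out (buildable now; lead). -/
theorem stub_rootedPairApprox :
    ∀ (G : Type) [Group G] [TopologicalSpace G] [IsTopologicalGroup G] [CompactSpace G]
      [MeasurableSpace G] [BorelSpace G], IsCompactSimpleLieGroup G →
    ∀ (r : LatticeRep G) (V E Q : ℕ → ℕ → Finset ℕ) (σ τ : ℕ → ℕ → ℕ → ℕ)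
    (bd : ℕ → ℕ → ℕ → Fin 4 → ℕ × Bool) (cV : ℕ → ℕ → ℕ → ℤ × ℤ → ℕ)
    (cE : ℕ → ℕ → ℕ → ℤ × ℤ → Fin 2 → ℕ × Bool),
    (∀ k j, 8 ≤ k → (Fam G r k j (V k j) (E k j) (Q k j) (σ k j) (τ k j) (bd k j) (cV k j) (cE k j)).1) →
    ∀ (β m : ℝ), 0 < m →
    (∀ A B : YMSpecies G, ∃ C : ℝ, ∃ K : ℕ, ∀ k, K ≤ k → Sp A (k / 8) → Sp B (k / 8) →
      ∃ j₀ : ℕ, ∀ j, j₀ ≤ j → (Fam G r k j (V k j) (E k j) (Q k j) (σ k j) (τ k j) (bd k j) (cV k j) (cE k j)).2 β m C A B) →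
    ∀ A B : YMSpecies G, ∃ C : ℝ, ∃ P : ℕ → Measure (LGConfig 4 G × LGConfig 4 G), IsPairApprox r β m C A B P := by
  sorry

/-- Registered stub `stub_pairLimit` (H₂b) : the statement `PairLimit` written out (buildable now; worker). -/
theorem stub_pairLimit :
    ∀ (G : Type) [Group G] [TopologicalSpace G] [IsTopologicalGroup G] [CompactSpace G]
      [MeasurableSpace G] [BorelSpace G], IsCompactSimpleLieGroup G →
    ∀ (r : LatticeRep G) (β m C : ℝ) (A B : YMSpecies G) (P : ℕ → Measure (LGConfig 4 G × LGConfig 4 G)),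
    IsPairApprox r β m C A B P →
    ∃ Q : Measure (LGConfig 4 G × LGConfig 4 G), IsRootedPairState r β Q ∧ ∀ n : ℕ,
      |(∫ p, A.F p.1 * B.F (configShift (-Pi.single 0 (n : ℤ)) p.1) ∂Q) -
          ∫ p, A.F p.1 * B.F (configShift (-Pi.single 0 (n : ℤ)) p.2) ∂Q| ≤ C * Real.exp (-(m * n)) := by
  sorry

/-- Registered stub `stub_extremalInvariantStates` (EXT) : the statement `ExtremalInvariantStates` written out (OPEN, NEW). -/
theorem stub_extremalInvariantStates :
    ∀ (G : Type) [Group G] [TopologicalSpace G] [IsTopologicalGroup G] [CompactSpace G]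
      [MeasurableSpace G] [BorelSpace G], IsCompactSimpleLieGroup G → ∀ r : LatticeRep G,
      ∃ βe : ℝ, ∀ β : ℝ, βe ≤ β → ∀ μ : MeasureTheory.Measure (LGConfig 4 G),
        μ ∈ ymGibbsMeasures r.ρ β → IsZdTranslationInvariant μ →
          IsExtremalGibbs (ymSpecification r.ρ β) μ := by
  sorry

/-- Registered stub `stub_torusFiniteSize` : the statement `TorusFiniteSize` written out (OPEN; shared verbatim). -/
theorem stub_torusFiniteSize :
    ∀ (G : Type) [Group G] [TopologicalSpace G] [IsTopologicalGroup G] [CompactSpace G]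
      [MeasurableSpace G] [BorelSpace G], IsCompactSimpleLieGroup G → ∀ (r : LatticeRep G) (β₃ : ℝ),
      (∀ β : ℝ, β₃ ≤ β → ∃ m : ℝ, 0 < m ∧
        ∀ A B : YMSpecies G, ∃ C : ℝ, ∀ μ : MeasureTheory.Measure (LGConfig 4 G),
          μ ∈ infiniteVolumeLimitPoints r.ρ β → ∀ n : ℕ,
            |(∫ U, A.F U * B.F (configShift (-Pi.single 0 (n : ℤ)) U) ∂μ) -
                (∫ U, A.F U ∂μ) * (∫ U, B.F (configShift (-Pi.single 0 (n : ℤ)) U) ∂μ)| ≤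
              C * Real.exp (-(m * n))) →
      ∃ β₀ : ℝ, ∀ β : ℝ, β₀ ≤ β → ∃ m : ℝ, 0 < m ∧ ∃ S₁ : ℕ, ∀ A B : YMSpecies G, ∃ C : ℝ,
        ∀ S n : ℕ, S₁ ≤ S → n ≤ S →
          |latticeConnectedCorr r.ρ β (2 * S + 1) A.F B.F n| ≤ C * Real.exp (-(m * n)) := by
  sorry

/-! ## Signature match (kernel-checked): each registered stub IS its named statement -/

example : RootedPairApprox := stub_rootedPairApprox
example : PairLimit := stub_pairLimit
example : ExtremalInvariantStates := stub_extremalInvariantStates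
example : TorusFiniteSize := stub_torusFiniteSize

/-! ## Landed stubs, by name -/

/-- (RT) is LANDED: `Theorems.HyperbolicToTorusR.stub_replicaDecoupling` (p173300) IS the statement `ReplicaDecoupling`. -/
theorem replicaDecoupling_holds : ReplicaDecoupling :=
  Summit.QuantumFields.YangMills.Theorems.HyperbolicToTorusR.stub_replicaDecoupling

/-! ## Glue (no `sorry`): H₂ from H₂a and H₂b -/

/-- **`rootedPairLimit_of : (H₂a) → (H₂b) → (H₂)`** — the finite-`k` approximating sequence of the family, fed to the abstract
pair-limit step, is a rooted pair state with the table. -/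
theorem rootedPairLimit_of (hA : RootedPairApprox) (hL : PairLimit) : RootedPairLimit := by
  intro G _ _ _ _ _ _ hG r V E Q σ τ bd cV cE hAdm β m hm hCl A B
  obtain ⟨C, P, hP⟩ := hA G hG r V E Q σ τ bd cV cE hAdm β m hm hCl A B
  obtain ⟨Qm, hQ, hT⟩ := hL G hG r β m C A B P hP
  exact ⟨Qm, hQ, C, hT⟩

/-! ## Name-keyed aliases of the stub statements — the hypotheses of `HyperbolicToTorusR_of` -/
namespace __Registered

/-- Alias of `RootedPairApprox` keyed by the registered stub name. -/
abbrev stub_rootedPairApprox : Prop := RootedPairApprox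
/-- Alias of `PairLimit` keyed by the registered stub name. -/
abbrev stub_pairLimit : Prop := PairLimit
/-- Alias of `ExtremalInvariantStates` keyed by the registered stub name. -/
abbrev stub_extremalInvariantStates : Prop := ExtremalInvariantStates
/-- Alias of `TorusFiniteSize` keyed by the registered stub name. -/
abbrev stub_torusFiniteSize : Prop := TorusFiniteSize

end __Registered

/-! ## Composition: the crux BY NAME from the four stub statements (no `sorry` below this line) -/

/-- **`HyperbolicToTorusR_of : (H₂a) → (H₂b) → (EXT) → (V) → HyperbolicToTorusR`.**  Fix `G`, `hG`, `r`, the Borel σ-algebra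
(the crux's own `letI := borel G`), the family and its two hypotheses; `β₁` from the clustering hypothesis, `β_e` from (EXT).
At each `β ≥ max β₁ β_e` and for each pair `(A, B)`: (H₂a)+(H₂b) turn the family at the FAMILY's rate `m(β)` into a rooted pair
state `Q` with table constant `C`; (EXT) gives extremality of translation-invariant DLR states, hence (landed Negative lemma)
their agreement on every species (U_tr); the LANDED (RT) decouples `Q` and yields `|cov_ν(A, τₙB)| ≤ C e^{−mn}` for every
translation-invariant DLR `ν`; every periodic limit point is DLR and translation invariant (LANDED theorems); (V) at threshold
`max β₁ β_e` is the crux's conclusion for `r`.  Conclusion = the route decl, by name. -/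
theorem HyperbolicToTorusR_of (hA : __Registered.stub_rootedPairApprox) (hL : __Registered.stub_pairLimit)
    (hE : __Registered.stub_extremalInvariantStates) (hV : __Registered.stub_torusFiniteSize) :
    Summit.QuantumFields.YangMills.Theses.HyperbolicRegulator.HyperbolicToTorusR := by
  have hH : RootedPairLimit := rootedPairLimit_of hA hL
  have hR : ReplicaDecoupling := replicaDecoupling_holds
  intro G _ _ _ _ hG r Fam₀ Sp₀ V E Q σ τ bd cV cE Φ hAdm hClust
  letI : MeasurableSpace G := borel G
  haveI : BorelSpace G := ⟨rfl⟩
  obtain ⟨β₁, hβ₁⟩ := hClust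
  -- `G` is Hausdorff and second countable: `r.ρ` is a closed embedding into a matrix space
  haveI : T2Space G := (r.continuous.isClosedEmbedding r.injective).isEmbedding.t2Space
  haveI : SecondCountableTopology G :=
    (r.continuous.isClosedEmbedding r.injective).isEmbedding.secondCountableTopology
  obtain ⟨βe, hβe⟩ := hE G hG r
  -- (V) at threshold `max β₁ βe`; its hypothesis is supplied by (H₂) + (EXT ⇒ U_tr) + (RT)
  refine hV G hG r (max β₁ βe) ?_
  intro β hβ
  have hβ1 : β₁ ≤ β := (le_max_left _ _).trans hβ
  have hβe' : βe ≤ β := (le_max_right _ _).trans hβ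
  obtain ⟨m, hm, hCl⟩ := hβ₁ β hβ1
  refine ⟨m, hm, fun A B => ?_⟩
  -- (H₂): the rooted pair state for the pair `(A, B)` at the family's rate
  obtain ⟨Qm, hQ, C, hC⟩ := hH G hG r V E Q σ τ bd cV cE hAdm β m hm hCl A B
  refine ⟨C, fun ν hν n => ?_⟩
  -- periodic limit points are DLR states and translation invariant (landed theorems)
  have hνG : ν ∈ ymGibbsMeasures r.ρ β :=
    mem_ymGibbsMeasures_of_mem_infiniteVolumeLimitPoints_holds (d := 4) r.ρ r.continuous hν
  have hνT : IsZdTranslationInvariant ν :=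
    Summit.QuantumFields.YangMills.Theorems.FibreToTorus.stub_torusLimitTranslationInvariant 4 r.N G r.ρ
      r.continuous β ν hν
  -- (EXT) at `β`, and (U_tr) at `β` from it (landed Negative lemma: EXT ⊇ translation-invariant uniqueness)
  have hEβ : ∀ μ : MeasureTheory.Measure (LGConfig 4 G), μ ∈ ymGibbsMeasures r.ρ β →
      IsZdTranslationInvariant μ → IsExtremalGibbs (ymSpecification r.ρ β) μ := fun μ hμ hμT => hβe β hβe' μ hμ hμT
  have hUtr : ∀ μ ν : MeasureTheory.Measure (LGConfig 4 G), μ ∈ ymGibbsMeasures r.ρ β →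
      ν ∈ ymGibbsMeasures r.ρ β → IsZdTranslationInvariant μ → IsZdTranslationInvariant ν →
        ∀ X : YMSpecies G, ∫ U, X.F U ∂μ = ∫ U, X.F U ∂ν :=
    Summit.QuantumFields.YangMills.Theorems.HyperbolicToTorusR.Negative.speciesIntegral_eq_of_extremal r.ρ β hEβ
      fun (X : YMSpecies G) U => X.F U
  -- (RT, landed): decoupling of the rooted pair state under U_tr ∧ EXT
  exact hR G hG r β m A B C hUtr hEβ ⟨Qm, hQ, hC⟩ ν hνG hνT n

/-- **Registered instantiation (kernel-checked)**: the four stubs BY NAME give the crux BY NAME. -/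
example : Summit.QuantumFields.YangMills.Theses.HyperbolicRegulator.HyperbolicToTorusR :=
  HyperbolicToTorusR_of stub_rootedPairApprox stub_pairLimit stub_extremalInvariantStates stub_torusFiniteSize

end Summit.QuantumFields.YangMills.Cruxes.HyperbolicToTorusR.ReplicaRooting

end
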